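import Summits.NavierStokesRegularity.NavierStokesRegularity.Theorems.SlicedKelvinPlanarFluxAPrioriLevelSetMultiplier
import HarnessLib

/-!
# Crux `SlicedKelvin.PlanarFluxAPriori` (stmt-NavierStokesRegularity-15600), line `Sketch`:
  the level-set multiplier method for `f = ⟪ω, n⟫` — time integration and the slab inequality

Support file 2 (`--supports stmt-NavierStokesRegularity-15600`) for the registered stub
`stub_apexLevelSetDissipation` (Constantin-type level-set dissipation budget for `ω·n`).

P. Constantin, *Navier–Stokes equations and area of interfaces*, Comm. Math. Phys. **129** (1990)
241–266, §3, (3.7)–(3.16): the slice identity of file 1 (`levelSet_slice_identity`),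
`∫ ψ G'(f) ∂ₜf = −ν ∫ ψ G''(f) ‖Df‖² + ∫ rest`, `f = ⟪curl u, n⟫`,
`rest = ν (Δψ) G(f) + G(f) (u·∇)ψ + ψ G'(f) ⟪(ω·∇)u, n⟫`, is integrated over a closed time slab
`[0, T']` for a classical solution of the unforced Navier–Stokes equations (the vorticity equation
`∂ₜω = νΔω − (u·∇)ω + (ω·∇)u` of `Literature/Analysis/FluidPDE/VorticityEquation`):

* `levelSet_integral_Ioo_integral_time` — `∫₀^{T'} ∫ ψ G'(f) ∂ₜf = ∫ ψ G(f(T')) − ∫ ψ G(f(0))`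
  (Fubini on `(0, T') × ℝ³` and the fundamental theorem of calculus on time lines);
* `levelSet_slab_le` — **the slab inequality**: for `G ≥ 0` with `G(s) ≤ M|s|` and a unit vector `n`,
  `ν ∫₀^{T'} ∫ ψ G''(f) ‖Df‖² ≤ M ∫ ψ |ω(0)| + |∫₀^{T'} ∫ rest|` (end-time term dropped).

This is the architecture of the in-tree `integral_Ioo_integral_mul_inner_timeDerivWithin_div_regN` and
`IsClassicalNSSolutionOn.direction_dissipation_slab_le` (`ConstantinDirectionDissipationProofs`),
with the scalar multiplier `G(f)` in place of the regularised modulus `N_ε − ε` — adapted from those.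

## References

* P. Constantin, *Navier–Stokes equations and area of interfaces*, Comm. Math. Phys. 129 (1990)
  241–266, §3, (3.7)–(3.16).
-/

noncomputable section

namespace Summit.NavierStokesRegularity.NavierStokesRegularity.Theorems.SlicedKelvinPlanarFluxAPriori

-- the summit and its single sub-problem share the name (CONVENTIONS §1)
set_option linter.dupNamespace false

open MeasureTheory Set Function Filter Metric Literature.Analysis.FluidPDE
open scoped RealInnerProductSpace ENNReal NNReal Laplacian Topology

/-! ### Time integration of `∫ ψ G'(f) ∂ₜf` on a closed time slab -/

section Time

variable {T' : ℝ} {w : ℝ → EuclideanSpace ℝ (Fin 3) → EuclideanSpace ℝ (Fin 3)}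

/-- **Time integration of `∫ ψ G'(f) ∂ₜf`**, `f = ⟪w, n⟫`. For a field `w` jointly smooth on
`[0, T'] × ℝ³`, `T' > 0`, a continuous compactly supported weight `ψ`, a multiplier `G` with
continuous derivative `G'` and a fixed vector `n`:
`∫₀^{T'} ∫ ψ G'(⟪w, n⟫) ⟪∂ₜw, n⟫ dx dτ = ∫ ψ G(⟪w(T'), n⟫) − ∫ ψ G(⟪w(0), n⟫)`
(Fubini on `(0, T') × ℝ³` and the fundamental theorem of calculus on each time line, where
`∂ₜ G(⟪w, n⟫) = G'(⟪w, n⟫) ⟪∂ₜw, n⟫`; Constantin 1990, the time integration of (3.12)). -/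
theorem levelSet_integral_Ioo_integral_time
    (hw : IsSmoothSpaceTimeOn (Icc 0 T') w) (hT' : 0 < T') {ψ : EuclideanSpace ℝ (Fin 3) → ℝ}
    (hψ : Continuous ψ) (hc : HasCompactSupport ψ) {G G' : ℝ → ℝ}
    (hG : ∀ s, HasDerivAt G (G' s) s) (hG'c : Continuous G') (n : EuclideanSpace ℝ (Fin 3)) :
    ∫ τ in Ioo 0 T', ∫ x, ψ x * (G' ⟪w τ x, n⟫ *
        ⟪Literature.Analysis.FluidPDE.timeDerivWithin (Icc 0 T') w τ x, n⟫) =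
      (∫ x, ψ x * G ⟪w T' x, n⟫) - ∫ x, ψ x * G ⟪w 0 x, n⟫ := by
  have hU : UniqueDiffOn ℝ (Icc 0 T') := uniqueDiffOn_Icc hT'
  have hw_cont : ContinuousOn (uncurry w) (Icc 0 T' ×ˢ univ) := hw.continuousOn
  have hdt_cont : ContinuousOn (uncurry (Literature.Analysis.FluidPDE.timeDerivWithin (Icc 0 T') w))
      (Icc 0 T' ×ˢ univ) := (hw.timeDerivWithin hU).continuousOn
  have hGc : Continuous G := levelSet_continuous_of_hasDerivAt hG
  have hKψ : ∀ x ∉ tsupport ψ, ψ x = 0 := fun x hx => image_eq_zero_of_notMem_tsupport hx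
  set D : ℝ × EuclideanSpace ℝ (Fin 3) → ℝ := fun z => ψ z.2 * (G' ⟪w z.1 z.2, n⟫ *
    ⟪Literature.Analysis.FluidPDE.timeDerivWithin (Icc 0 T') w z.1 z.2, n⟫) with hD
  have hDcont : ContinuousOn D (Icc 0 T' ×ˢ univ) :=
    (hψ.comp continuous_snd).continuousOn.mul
      ((hG'c.comp_continuousOn (hw_cont.inner continuousOn_const)).mul
        (hdt_cont.inner continuousOn_const))
  have hDK : ∀ τ ∈ Icc 0 T', ∀ x ∉ tsupport ψ, D (τ, x) = 0 := fun τ _ x hx => by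
    simp [hD, hKψ x hx]
  have hDint := integrable_prod_of_continuousOn hc hDcont hDK
  have hswap := integral_integral_swap (f := fun τ x => D (τ, x)) hDint
  simp only [hD] at hswap
  rw [hswap]
  have hslice : ∀ {r : ℝ}, r ∈ Icc 0 T' →
      Integrable (fun x => ψ x * G ⟪w r x, n⟫) (volume : Measure (EuclideanSpace ℝ (Fin 3))) :=
    fun hr => (hψ.mul (hGc.comp ((hw.contDiff_slice hr).continuous.inner
      continuous_const))).integrable_of_hasCompactSupport hc.mul_right
  have hTI : T' ∈ Icc 0 T' := ⟨hT'.le, le_rfl⟩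
  have h0I : (0 : ℝ) ∈ Icc 0 T' := ⟨le_rfl, hT'.le⟩
  have hline : ∀ x, ∫ τ in Ioo 0 T', ψ x * (G' ⟪w τ x, n⟫ *
      ⟪Literature.Analysis.FluidPDE.timeDerivWithin (Icc 0 T') w τ x, n⟫) =
      ψ x * G ⟪w T' x, n⟫ - ψ x * G ⟪w 0 x, n⟫ := by
    intro x
    have hwx : ContinuousOn (fun τ => w τ x) (Icc 0 T') :=
      hw_cont.comp (Continuous.prodMk_left x).continuousOn
        fun τ hτ => mk_mem_prod hτ (mem_univ x)
    have hcont : ContinuousOn (fun τ => ψ x * G ⟪w τ x, n⟫) (Icc 0 T') :=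
      continuousOn_const.mul (hGc.comp_continuousOn (hwx.inner continuousOn_const))
    have hderiv : ∀ τ ∈ Ioo 0 T', HasDerivWithinAt (fun τ => ψ x * G ⟪w τ x, n⟫)
        (ψ x * (G' ⟪w τ x, n⟫ *
          ⟪Literature.Analysis.FluidPDE.timeDerivWithin (Icc 0 T') w τ x, n⟫)) (Ioi τ) τ := by
      intro τ hτ
      have hw' : HasDerivAt (fun σ => w σ x)
          (Literature.Analysis.FluidPDE.timeDerivWithin (Icc 0 T') w τ x) τ :=
        (hw.hasDerivWithinAt_timeDerivWithin hU (Ioo_subset_Icc_self hτ) x).hasDerivAt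
          (Icc_mem_nhds hτ.1 hτ.2)
      have h1 : HasDerivAt (fun σ => ⟪w σ x, n⟫)
          ⟪Literature.Analysis.FluidPDE.timeDerivWithin (Icc 0 T') w τ x, n⟫ τ := by
        have := hw'.inner ℝ (hasDerivAt_const τ n)
        simpa only [inner_zero_right, zero_add] using this
      have h2 : HasDerivAt (fun σ => G ⟪w σ x, n⟫)
          (G' ⟪w τ x, n⟫ * ⟪Literature.Analysis.FluidPDE.timeDerivWithin (Icc 0 T') w τ x, n⟫) τ :=
        (hG _).comp τ h1
      exact (h2.const_mul (ψ x)).hasDerivWithinAt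
    have hint : IntervalIntegrable (fun τ => ψ x * (G' ⟪w τ x, n⟫ *
        ⟪Literature.Analysis.FluidPDE.timeDerivWithin (Icc 0 T') w τ x, n⟫)) volume 0 T' := by
      refine ContinuousOn.intervalIntegrable ?_
      rw [uIcc_of_le hT'.le]
      exact hDcont.comp (Continuous.prodMk_left x).continuousOn
        fun τ hτ => mk_mem_prod hτ (mem_univ x)
    have := intervalIntegral.integral_eq_sub_of_hasDeriv_right_of_le hT'.le hcont hderiv hint
    rw [intervalIntegral.integral_of_le hT'.le, integral_Ioc_eq_integral_Ioo] at this
    rw [this]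
  rw [integral_congr_ae (Eventually.of_forall hline), integral_sub (hslice hTI) (hslice h0I)]

/-- Joint continuity on `S × ℝ³` of the level-set dissipation density
`G''(⟪w, n⟫) ‖D⟪w(τ), n⟫(x)‖²` of a jointly smooth field (`S` of unique differentiability,
`G''` continuous): `D⟪w(τ), n⟫(x) = ⟪n, ·⟫ ∘ D(w τ)(x)` and the slice derivatives are jointly
continuous. -/
theorem levelSet_continuousOn_dissipation {S : Set ℝ} (hw : IsSmoothSpaceTimeOn S w)
    (hS : UniqueDiffOn ℝ S) {G'' : ℝ → ℝ} (hG''c : Continuous G'') (n : EuclideanSpace ℝ (Fin 3)) :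
    ContinuousOn (fun z : ℝ × EuclideanSpace ℝ (Fin 3) =>
      G'' ⟪w z.1 z.2, n⟫ * ‖fderiv ℝ (fun y => ⟪w z.1 y, n⟫) z.2‖ ^ 2) (S ×ˢ univ) := by
  have hw_c : ContinuousOn (uncurry w) (S ×ˢ univ) := hw.continuousOn
  have hDw_c : ContinuousOn (fun z : ℝ × EuclideanSpace ℝ (Fin 3) => fderiv ℝ (w z.1) z.2)
      (S ×ˢ univ) := hw.continuousOn_fderiv_slice hS
  have hLeq : ∀ z ∈ S ×ˢ (univ : Set (EuclideanSpace ℝ (Fin 3))),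
      fderiv ℝ (fun y => ⟪w z.1 y, n⟫) z.2 = (innerSL ℝ n).comp (fderiv ℝ (w z.1) z.2) :=
    fun z hz => levelSet_fderiv_inner_const_eq
      (((hw.contDiff_slice hz.1).differentiable (by simp)).differentiableAt) n
  have hL : ContinuousOn (fun z : ℝ × EuclideanSpace ℝ (Fin 3) =>
      fderiv ℝ (fun y => ⟪w z.1 y, n⟫) z.2) (S ×ˢ univ) :=
    (continuousOn_const.clm_comp hDw_c).congr hLeq
  exact (hG''c.comp_continuousOn (hw_c.inner continuousOn_const)).mul (hL.norm.pow 2)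

end Time

/-! ### The slab inequality for a classical solution on a closed slab -/

section Slab

variable {ν T' : ℝ} {u : ℝ → EuclideanSpace ℝ (Fin 3) → EuclideanSpace ℝ (Fin 3)}
  {p : ℝ → EuclideanSpace ℝ (Fin 3) → ℝ}

/-- **The slab inequality** (Constantin 1990, §3, (3.12)–(3.14) integrated over `(0, T') × ℝ³`
against a cut-off, the dissipation kept and the end-time term dropped): for a classical solution
of the unforced Navier–Stokes equations on `[0, T'] × ℝ³` (`T' > 0`, `ν ≥ 0`), a nonnegative
`ψ ∈ C²_c`, a unit vector `n`, `ω = curl u`, `f = ⟪ω, n⟫`, and a `C²` multiplier `G ≥ 0` with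
`G(s) ≤ M|s|` (`G' = dG/ds`, `G'' = dG'/ds` continuous),
`ν ∫₀^{T'} ∫ ψ G''(f) ‖Df‖² ≤ M ∫ ψ |ω(0)| + |∫₀^{T'} ∫ rest|`,
`rest = ν (Δψ) G(f) + G(f) Dψ[u] + ψ G'(f) ⟪Du[ω], n⟫`: insert the vorticity equation
`∂ₜω = νΔω − Dω[u] + Du[ω]` (`VorticityEquation`) into the slice identity
(`levelSet_slice_identity`), integrate in time (`levelSet_integral_Ioo_integral_time`), drop
`∫ ψ G(f(T')) ≥ 0` and bound `∫ ψ G(f(0)) ≤ M ∫ ψ |f(0)| ≤ M ∫ ψ |ω(0)|`. -/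
theorem levelSet_slab_le : ∀ (ν T' : ℝ) (u : ℝ → EuclideanSpace ℝ (Fin 3) → EuclideanSpace ℝ (Fin 3)) (p : ℝ → EuclideanSpace ℝ (Fin 3) → ℝ), Literature.Analysis.FluidPDE.IsClassicalNSSolutionOn (Set.Icc 0 T') ν 0 u p → 0 < T' → 0 ≤ ν → ∀ (ψ : EuclideanSpace ℝ (Fin 3) → ℝ), ContDiff ℝ 2 ψ → HasCompactSupport ψ → (∀ x, 0 ≤ ψ x) → ∀ (G G' G'' : ℝ → ℝ) (M : ℝ), (∀ s, HasDerivAt G (G' s) s) → (∀ s, HasDerivAt G' (G'' s) s) → Continuous G'' → (∀ s, 0 ≤ G s) → (∀ s, G s ≤ M * |s|) → ∀ (n : EuclideanSpace ℝ (Fin 3)), ‖n‖ = 1 → ν * ∫ τ in Set.Ioo 0 T', ∫ x, ψ x * (G'' (inner ℝ (Literature.Analysis.FluidPDE.vorticity u τ x) n) * ‖fderiv ℝ (fun z => inner ℝ (Literature.Analysis.FluidPDE.vorticity u τ z) n) x‖ ^ 2) ≤ M * (∫ x, ψ x * ‖Literature.Analysis.FluidPDE.vorticity u 0 x‖) + |∫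 τ in Set.Ioo 0 T', ∫ x, (ν * (Laplacian.laplacian ψ x * G (inner ℝ (Literature.Analysis.FluidPDE.vorticity u τ x) n)) + G (inner ℝ (Literature.Analysis.FluidPDE.vorticity u τ x) n) * fderiv ℝ ψ x (u τ x) + ψ x * (G' (inner ℝ (Literature.Analysis.FluidPDE.vorticity u τ x) n) * inner ℝ (fderiv ℝ (u τ) x (Literature.Analysis.FluidPDE.vorticity u τ x)) n))| := by
  intro ν T' u p hns hT' hν ψ hψ hψc hψ0 G G' G'' M hG hG' hG''c hG0 hGM n hn
  have hU : UniqueDiffOn ℝ (Icc 0 T') := uniqueDiffOn_Icc hT'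
  have hcl : Icc 0 T' ⊆ closure (interior (Icc 0 T')) := by
    rw [interior_Icc, closure_Ioo hT'.ne]
  set w := vorticity u with hwdef
  have hw : IsSmoothSpaceTimeOn (Icc 0 T') w := hns.isSmoothSpaceTimeOn_vorticity hU
  have hGc : Continuous G := levelSet_continuous_of_hasDerivAt hG
  have hG'c : Continuous G' := levelSet_continuous_of_hasDerivAt hG'
  have hM0 : 0 ≤ M := by
    have := (hG0 1).trans (hGM 1)
    simpa using this
  -- joint continuity of the building blocks
  have hw_c : ContinuousOn (uncurry w) (Icc 0 T' ×ˢ univ) := hw.continuousOn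
  have hu_c : ContinuousOn (uncurry u) (Icc 0 T' ×ˢ univ) := hns.smooth_velocity.continuousOn
  have hDu_c : ContinuousOn (uncurry fun τ x => fderiv ℝ (u τ) x) (Icc 0 T' ×ˢ univ) :=
    (hns.smooth_velocity.fderiv_slice hU).continuousOn
  have hf_c : ContinuousOn (fun z : ℝ × EuclideanSpace ℝ (Fin 3) => ⟪w z.1 z.2, n⟫)
      (Icc 0 T' ×ˢ univ) := hw_c.inner continuousOn_const
  have hψ_c : ContinuousOn (fun z : ℝ × EuclideanSpace ℝ (Fin 3) => ψ z.2) (Icc 0 T' ×ˢ univ) :=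
    (hψ.continuous.comp continuous_snd).continuousOn
  have hK : IsCompact (tsupport ψ) := hψc
  have hKψ : ∀ x ∉ tsupport ψ, ψ x = 0 := fun x hx => image_eq_zero_of_notMem_tsupport hx
  -- the slab functions
  set P : ℝ → EuclideanSpace ℝ (Fin 3) → ℝ := fun τ x =>
    ψ x * (G'' ⟪w τ x, n⟫ * ‖fderiv ℝ (fun z => ⟪w τ z, n⟫) x‖ ^ 2) with hP
  set Rr : ℝ → EuclideanSpace ℝ (Fin 3) → ℝ := fun τ x => ν * ((Δ ψ) x * G ⟪w τ x, n⟫)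
    + G ⟪w τ x, n⟫ * fderiv ℝ ψ x (u τ x)
    + ψ x * (G' ⟪w τ x, n⟫ * ⟪fderiv ℝ (u τ) x (w τ x), n⟫) with hRr
  have hPc : ContinuousOn (uncurry P) (Icc 0 T' ×ˢ univ) :=
    hψ_c.mul (levelSet_continuousOn_dissipation hw hU hG''c n)
  have hRc : ContinuousOn (uncurry Rr) (Icc 0 T' ×ˢ univ) := by
    refine ((continuousOn_const.mul ((((continuous_laplacian hψ).comp
      continuous_snd).continuousOn).mul (hGc.comp_continuousOn hf_c))).add
      ((hGc.comp_continuousOn hf_c).mul ?_)).add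
      (hψ_c.mul ((hG'c.comp_continuousOn hf_c).mul
        ((hDu_c.clm_apply hw_c).inner continuousOn_const)))
    exact (((hψ.continuous_fderiv (by norm_num)).comp continuous_snd).continuousOn).clm_apply hu_c
  have hPK : ∀ τ ∈ Icc 0 T', ∀ x ∉ tsupport ψ, P τ x = 0 := fun τ _ x hx => by
    simp only [hP, hKψ x hx, zero_mul]
  have hRK : ∀ τ ∈ Icc 0 T', ∀ x ∉ tsupport ψ, Rr τ x = 0 := fun τ _ x hx => by
    simp only [hRr, hKψ x hx, laplacian_eq_zero_of_notMem_tsupport hx,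
      fderiv_of_notMem_tsupport ℝ hx]
    simp
  -- integrability in time of the space integrals
  have hPi := integrableOn_Ioo_integral_of_continuousOn hK hPc hPK
  have hRi := integrableOn_Ioo_integral_of_continuousOn hK hRc hRK
  -- the vorticity equation, solved for `∂ₜω`
  have hV : ∀ τ ∈ Icc 0 T', ∀ x, Literature.Analysis.FluidPDE.timeDerivWithin (Icc 0 T') w τ x =
      ν • (Δ (w τ)) x - fderiv ℝ (w τ) x (u τ x) + fderiv ℝ (u τ) x (w τ x) := by
    intro τ hτ x
    have h := hns.vorticity_eq hU hcl (fun _ _ x => curl_zero x) hτ x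
    simp only [convect_apply] at h
    rw [hwdef]
    rw [← sub_eq_zero] at h ⊢
    rw [← h]
    abel
  -- the slice identity, for every `τ ∈ [0, T']`
  have hE1 : ∀ τ ∈ Icc 0 T', ∫ x, ψ x * (G' ⟪w τ x, n⟫ *
      ⟪Literature.Analysis.FluidPDE.timeDerivWithin (Icc 0 T') w τ x, n⟫) =
      -(ν * ∫ x, P τ x) + ∫ x, Rr τ x := by
    intro τ hτ
    have hω2 : ContDiff ℝ 2 (w τ) := hns.contDiff_two_vorticity hτ
    have hu1 : ContDiff ℝ 1 (u τ) := (hns.contDiff_velocity hτ).of_le (by exact_mod_cast le_top)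
    have h := levelSet_slice_identity ν (w τ) (u τ) ψ n G G' G'' hω2 hu1 (hns.divFree τ hτ) hψ
      hψc hG hG' hG''c
    rw [← h]
    refine integral_congr_ae (Eventually.of_forall fun x => ?_)
    simp only [hV τ hτ x]
  -- time integration of the left-hand side
  have hD := levelSet_integral_Ioo_integral_time hw hT' hψ.continuous hψc hG hG'c n
  have hcongr : ∫ τ in Ioo 0 T', ∫ x, ψ x * (G' ⟪w τ x, n⟫ *
      ⟪Literature.Analysis.FluidPDE.timeDerivWithin (Icc 0 T') w τ x, n⟫) =
      ∫ τ in Ioo 0 T', (-(ν * ∫ x, P τ x) + ∫ x, Rr τ x) :=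
    setIntegral_congr_fun measurableSet_Ioo fun τ hτ => hE1 τ (Ioo_subset_Icc_self hτ)
  have hsplit : ∫ τ in Ioo 0 T', (-(ν * ∫ x, P τ x) + ∫ x, Rr τ x) =
      -(ν * ∫ τ in Ioo 0 T', ∫ x, P τ x) + ∫ τ in Ioo 0 T', ∫ x, Rr τ x := by
    rw [integral_add ?_ hRi, integral_neg, integral_const_mul]
    exact (hPi.const_mul ν).neg
  -- signs of the end terms
  have hA1 : 0 ≤ ∫ x, ψ x * G ⟪w T' x, n⟫ :=
    integral_nonneg fun x => mul_nonneg (hψ0 x) (hG0 _)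
  have hA0 : ∫ x, ψ x * G ⟪w 0 x, n⟫ ≤ M * ∫ x, ψ x * ‖w 0 x‖ := by
    have h0I : (0 : ℝ) ∈ Icc 0 T' := ⟨le_rfl, hT'.le⟩
    have hc0 : Continuous (w 0) := (hw.contDiff_slice h0I).continuous
    rw [← integral_const_mul]
    refine integral_mono ?_ ?_ fun x => ?_
    · exact (hψ.continuous.mul (hGc.comp (hc0.inner continuous_const)))
        |>.integrable_of_hasCompactSupport hψc.mul_right
    · exact ((hψ.continuous.mul hc0.norm).integrable_of_hasCompactSupport hψc.mul_right).const_mul M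
    · have h1 : G ⟪w 0 x, n⟫ ≤ M * ‖w 0 x‖ := by
        refine (hGM _).trans (mul_le_mul_of_nonneg_left ?_ hM0)
        have := abs_real_inner_le_norm (w 0 x) n
        rwa [hn, mul_one] at this
      calc ψ x * G ⟪w 0 x, n⟫ ≤ ψ x * (M * ‖w 0 x‖) := mul_le_mul_of_nonneg_left h1 (hψ0 x)
        _ = M * (ψ x * ‖w 0 x‖) := by ring
  -- conclude
  have key : ν * ∫ τ in Ioo 0 T', ∫ x, P τ x =
      (∫ τ in Ioo 0 T', ∫ x, Rr τ x) - (∫ x, ψ x * G ⟪w T' x, n⟫)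
        + ∫ x, ψ x * G ⟪w 0 x, n⟫ := by
    have := hD
    rw [hcongr, hsplit] at this
    linarith
  show ν * ∫ τ in Ioo 0 T', ∫ x, P τ x ≤
    M * (∫ x, ψ x * ‖w 0 x‖) + |∫ τ in Ioo 0 T', ∫ x, Rr τ x|
  rw [key]
  linarith [le_abs_self (∫ τ in Ioo 0 T', ∫ x, Rr τ x)]

end Slab

end Summit.NavierStokesRegularity.NavierStokesRegularity.Theorems.SlicedKelvinPlanarFluxAPriori
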